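import Summits.AtomisticToContinuum.Crystallization.Theorems.ChartedZeroExcessLayeredLatticeLiouvilleZZZYK

/-!
(SPLIT FOR THE 400-LINE CAP by the landing lane, hand-2 g44: this file = part A; part B = `…ChartedZeroExcessLayeredLatticeLiouvilleZZZYL` imports it; same namespace, all FQNs unchanged.)
# ChartedZeroExcess · LayeredLatticeLiouville ZZZYL (lens-2 g95 NODE 95 «LedgerWindow») — THE BREGMAN COERCIVITY (BCᴸ′) CUT INTO THE FIRST VARIATION
# OF THE CLAMPED ENERGY (LDᴸ) AND A BONDWISE LEDGER FLOOR (QLᴸ)(c); THE TRANSVERSE-EXCESS BOUND AND THE GLUE PROVED; DOOR W2k.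
Docket `stmt-AtomisticToContinuum-26636` (crux `ChartedZeroExcessLayered`), W2 line.  Residual of record after g94 (critic r1648 (b)): (X1ᴸ′), (X2ᴸ′), (KAᴸ′),
(C2ᴸ′) `ChordCalculusP`, (HSᴸ′)(c) `SoftHessianStableP … c`, (OGʰ′⋆)(g₀), door `mildCoherentMoatCorePG_W2i` (tree ZZZYK); its parent leaf (BCᴸ′)(c)
`SoftBregmanCoerciveP … c` (tree ZZZYI, door W2h).
WHY A SIBLING BRANCH BENEATH (BCᴸ′) (desk finding «WINDOW-LOSSY-95», memo NODE-g95.md §1): the cut of (HSᴸ′) asked for in r1648 (c) — a clamped pre-stressed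
form floor at the placed LABEL crystal (HS₀) plus a chord-coefficient drift bound (HSδ) — is FALSE-type at the registered dials: along a chord the bond
lengths move by up to `sb₁ + τ⋆ ≈ 0.037`, three quarters of the Lennard-Jones anharmonicity length `V''/|V'''| ≈ 0.048`, and a Bloch scan of every
`v`-independent windowed coefficient table on the clean-admissible label crystals is NEGATIVE (desk `window_bloch.py`).  The Hessian-for-all-`t` route pays the
softening at the WORST chord point; the energy LEDGER pays it through the one-dimensional Bregman remainder of each bond (Taylor kernel weight `(1 − t)`,
a third of the drift by Jensen) and charges the pre-stress at the filling's own bond length — ten times better conditioned, and EXACT bondwise.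
THIS FILE (all PROVED, 0 sorry) — the cut of (BCᴸ′) one implication layer down, into a first-variation statement (LDᴸ) that is then DISCHARGED and a
single typed piece (QLᴸ)(c), glue and doors PROVED:
* **(LDᴸ) `FirstVariationP` — PROVED (`firstVariationP_holds`, §ZZZYL-3)**: the clamped energy has a Fréchet derivative at every injective filling `y` off the
  frozen set, given by the pair-derivative formula (interior pairs `pairDeriv (y i) (y j) (w i − w j)` over `i < j`, exterior pairs `∑' q, pairDeriv (y i) q (w i)`,
  absolutely convergent) — tree N-force-balance's `hasFDerivAt_siteEnergy` ported from an atom to an arbitrary base point with positive clearance from the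
  `δ`-separated frozen set (`exists_pos_le_dist_of_isSep`, `hasFDerivAt_tsum_exterior_of_clear`);
* **(QLᴸ) `SoftLedgerFloorP … c`** — THE CONTENT, the only open piece of this branch: for every soft fat-tube `z`, `c · pairDevSq ≤ Σ_bonds pairLedgerLower`, the
  BONDWISE LOWER LEDGER `pairLedgerLower b v = min (V'(‖b‖)) 0 · ‖v‖²/(2‖b‖) + bondBregman V V' ‖b‖ ‖b + v‖` (exact one-dimensional stretch remainder; transverse
  excess pessimised to its sharp maximum `‖v‖²/(2‖b‖)`, tension credits dropped) — an explicit function of the bond lengths of `y` and `z` and of `‖v‖`, no energy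
  functional, no derivative: the certificate target;
* PROVED: the SHARP transverse-excess bound `bondExcess b v ≤ ‖v‖²/(2‖b‖)` (tree ZZZYI had `‖v‖²/‖b‖`), the bondwise domination
  `pairLedgerLower b v ≤ V(‖b + v‖) − V(‖b‖) − V'(‖b‖)‖b‖⁻¹⟪b, v⟫` (every `b ≠ 0`, every `v` — junk-consistent, so no collision hypothesis is needed), the glue
  `softBregmanCoerciveP_of_ledger : (LDᴸ) → (QLᴸ)(c) → (BCᴸ)(c)` (ledger identity: criticality kills the linear terms, `tsum` linearity on the summable
  exterior) and its one-piece form `softBregmanCoerciveP_of_ledgerFloor : (QLᴸ)(c) → (BCᴸ)(c)`, the hull-modulus Taylor bound `bondBregman ≥ (m/2)·d²` for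
  `m ≤ V''` on the segment, the window monotonicity of `V''` (`V⁽³⁾ ≤ 0` below `(13/4)^{1/6}`) with the longer-end bound, the global floor `V'' ≥ −2/3`, and the
  doors `mildCoherentMoatCorePG_W2k` (= tree W2h with (BCᴸ′) from the two-piece glue) and `mildCoherentMoatCorePG_W2l` (the same with (LDᴸ′) discharged).
W2 RESIDUAL AFTER THIS FILE (ledger branch): (X1ᴸ′) ∧ (X2ᴸ′) ∧ (KAᴸ′) ∧ (QLᴸ′)(c > 0) ∧ (OGʰ′⋆)(g₀ > 0), door W2l; the Hessian branch (C2ᴸ′) ∧ (HSᴸ′) of tree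
ZZZYK stays typed as the sibling.
0 sorry · import = tree ZZZYK only · 4 defs (`pairLedgerLower`, `ljThirdDeriv`, the `Prop` statements (LDᴸ)(QLᴸ)), 20 theorems · no instances/notation/options · axioms standard. [g95]
-/

noncomputable section
open scoped BigOperators Classical InnerProductSpace RealInnerProductSpace
open MeasureTheory Set Metric Filter Topology
open Literature.MathematicalPhysics.StatisticalMechanics (lennardJones interactionEnergy)

namespace Summit.AtomisticToContinuum.Crystallization.Theorems.ChartedZeroExcessLayeredLatticeLiouville

open Summit.AtomisticToContinuum.Crystallization.Theorems.ChartedPlanarOrderRigidityDoor (E3 IsClean)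
open Summit.AtomisticToContinuum.Crystallization.Theorems.ChartedPlanarOrderDensityDichotomy (μS IsSep)
open Summit.AtomisticToContinuum.Crystallization.Theorems.ChartedPlanarOrderCleanScaleP (IsCleanP IsDoorSetP)
open Summit.AtomisticToContinuum.Crystallization.Theorems.ChartedPlanarOrderMesoCut (LayeredHom EnvClose)
open Summit.AtomisticToContinuum.Crystallization.Theorems.ChartedPlanarOrderDoorLayeredOsc (IsTwoShellAffineGood)
open Summit.AtomisticToContinuum.Crystallization.Theorems.ChartedPlanarOrderNashForceBalance (ljDeriv pairDeriv hasDerivAt_lennardJones hasFDerivAt_pair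
  norm_pairDeriv_le inv_pow_le_of_half_le inv_pow_add_le)

/-! ### ZZZYL-1  The bondwise lower ledger (real analysis, PROVED) -/

section Ledger

/-- ★★ **THE SHARP TRANSVERSE-EXCESS BOUND (PROVED, no smallness)**: `bondExcess b v ≤ ‖v‖²/(2‖b‖)` for `b ≠ 0` — attained asymptotically by pure rotations
of the bond (`‖b + v‖ = ‖b‖`), whence the factor `1/2` is the right constant of the pre-stress charge. (`2xy ≤ x² + y²` with `x = ‖b‖`, `y = ‖b + v‖`.)
[this file, g95] -/
theorem bondExcess_le_sq_div_two {b : E3} (hb : b ≠ 0) (v : E3) : bondExcess b v ≤ ‖v‖ ^ 2 / (2 * ‖b‖) := by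
  unfold bondExcess
  have hnb : 0 < ‖b‖ := norm_pos_iff.2 hb
  have hsq : ‖b + v‖ ^ 2 = ‖b‖ ^ 2 + 2 * ⟪b, v⟫ + ‖v‖ ^ 2 := norm_add_sq_real b v
  have hkey : 2 * ‖b‖ * ‖b + v‖ ≤ ‖b‖ ^ 2 + ‖b + v‖ ^ 2 := by nlinarith [sq_nonneg (‖b + v‖ - ‖b‖)]
  have key2 : ‖b + v‖ - ‖b‖ ≤ (⟪b, v⟫ + ‖v‖ ^ 2 / 2) / ‖b‖ := by
    rw [le_div_iff₀ hnb]
    nlinarith [hkey, hsq]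
  rw [add_div, div_div] at key2
  linarith

/-- ★ **THE PRE-STRESS CHARGE (PROVED)**: the tension term of the ledger is at least the compression (if any) times the sharp maximal excess:
`min (V'(‖b‖)) 0 · ‖v‖²/(2‖b‖) ≤ V'(‖b‖) · bondExcess b v` (`b ≠ 0`; tension credits `V' > 0` are dropped to `0`). [this file, g95] -/
theorem tension_mul_excess_ge {b : E3} (hb : b ≠ 0) (v : E3) :
    min (ljDeriv ‖b‖) 0 * (‖v‖ ^ 2 / (2 * ‖b‖)) ≤ ljDeriv ‖b‖ * bondExcess b v := by
  have hnb : 0 < ‖b‖ := norm_pos_iff.2 hb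
  have hX0 : 0 ≤ bondExcess b v := bondExcess_nonneg b v
  have hX1 : bondExcess b v ≤ ‖v‖ ^ 2 / (2 * ‖b‖) := bondExcess_le_sq_div_two hb v
  have hs : 0 ≤ ‖v‖ ^ 2 / (2 * ‖b‖) := by positivity
  rcases le_or_gt 0 (ljDeriv ‖b‖) with hpos | hneg
  · rw [min_eq_right hpos, zero_mul]
    exact mul_nonneg hpos hX0
  · rw [min_eq_left hneg.le]
    exact mul_le_mul_of_nonpos_left hX1 hneg.le

/-- ★★ **`pairLedgerLower b v` — THE BONDWISE LOWER LEDGER** of the bond `b` under the relative displacement `v`: the pre-stress charge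
`min (V'(‖b‖)) 0 · ‖v‖²/(2‖b‖)` (compression times the sharp maximal transverse excess) plus the EXACT one-dimensional stretch remainder
`bondBregman V V' ‖b‖ ‖b + v‖ = V(‖b + v‖) − V(‖b‖) − V'(‖b‖)(‖b + v‖ − ‖b‖)`.  An explicit function of the two bond lengths and `‖v‖` (interval-arithmetic
friendly); it is the pair energy change minus its linearisation, pessimised only through the transverse excess (tight for rotations). [this file, g95] -/
def pairLedgerLower (b v : E3) : ℝ :=
  min (ljDeriv ‖b‖) 0 * (‖v‖ ^ 2 / (2 * ‖b‖)) + bondBregman lennardJones ljDeriv ‖b‖ ‖b + v‖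

/-- ★★ **BONDWISE DOMINATION (PROVED, every `b ≠ 0`, every `v`)**: the lower ledger is below the pair energy change minus its linearisation. [this file, g95] -/
theorem pairLedgerLower_le {b : E3} (hb : b ≠ 0) (v : E3) :
    pairLedgerLower b v ≤ lennardJones ‖b + v‖ - lennardJones ‖b‖ - ljDeriv ‖b‖ * ‖b‖⁻¹ * ⟪b, v⟫ := by
  rw [pair_ledger lennardJones ljDeriv b v]
  unfold pairLedgerLower
  linarith [tension_mul_excess_ge hb v]

/-- ★★ **THE SAME IN THE TREE'S TERMS (PROVED)**: `pairLedgerLower (x − q) v ≤ V(‖x + v − q‖) − V(‖x − q‖) − pairDeriv x q v` for `x ≠ q`. [this file, g95] -/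
theorem pairLedgerLower_le_pairTerm {x q : E3} (hx : x ≠ q) (v : E3) :
    pairLedgerLower (x - q) v ≤ lennardJones ‖x + v - q‖ - lennardJones ‖x - q‖ - pairDeriv x q v := by
  rw [lennardJones_pair_ledger x q v]
  unfold pairLedgerLower
  linarith [tension_mul_excess_ge (sub_ne_zero.2 hx) v]

/-- ★ **THE HULL-MODULUS TAYLOR BOUND (PROVED) — the certificate's first brick**: if `m ≤ V''` on the segment between two POSITIVE lengths `l`, `l'`, then
`(m/2)(l' − l)² ≤ bondBregman V V' l l'` (tree ZZZYK's `taylor_lower_of_deriv2` along `t ↦ l + t(l' − l)`). [this file, g95] -/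
theorem bondBregman_ge_of_le_deriv2 {l l' m : ℝ} (hl : 0 < l) (hl' : 0 < l')
    (hm : ∀ t ∈ Icc (0 : ℝ) 1, m ≤ ljSecondDeriv (l + t * (l' - l))) : m / 2 * (l' - l) ^ 2 ≤ bondBregman lennardJones ljDeriv l l' := by
  set d := l' - l with hd
  have hpos : ∀ t ∈ Icc (0 : ℝ) 1, l + t * d ≠ 0 := fun t ht => by
    have : 0 < (1 - t) * l + t * l' := by
      rcases eq_or_lt_of_le ht.2 with e | hlt
      · rw [e]; simpa using hl'
      · nlinarith [ht.1, mul_nonneg ht.1 hl'.le]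
    intro h0; apply this.ne'; rw [hd] at h0; linarith
  have hγ : ∀ t : ℝ, HasDerivAt (fun s : ℝ => l + s * d) d t := fun t => by
    simpa using ((hasDerivAt_id' t).mul_const d).const_add l
  have hf : ∀ t ∈ Icc (0 : ℝ) 1, HasDerivAt (fun s => lennardJones (l + s * d) - s * (d * ljDeriv l)) (d * ljDeriv (l + t * d) - d * ljDeriv l) t :=
    fun t ht => by
      have h1 := (hasDerivAt_lennardJones (hpos t ht)).comp t (hγ t)
      have h2 := (hasDerivAt_id' t).mul_const (d * ljDeriv l)
      refine (h1.sub h2).congr_deriv ?_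
      ring
  have hg : ∀ t ∈ Icc (0 : ℝ) 1, HasDerivAt (fun s => d * ljDeriv (l + s * d) - d * ljDeriv l) (d * d * ljSecondDeriv (l + t * d)) t :=
    fun t ht => by
      have h1 := ((hasDerivAt_ljDeriv (hpos t ht)).comp t (hγ t)).const_mul d
      refine ((h1.sub_const (d * ljDeriv l))).congr_deriv ?_
      ring
  have hg0 : (fun s => d * ljDeriv (l + s * d) - d * ljDeriv l) 0 = 0 := by
    show d * ljDeriv (l + 0 * d) - d * ljDeriv l = 0
    rw [zero_mul, add_zero, sub_self]
  have hh : ∀ t ∈ Icc (0 : ℝ) 1, m * d ^ 2 ≤ d * d * ljSecondDeriv (l + t * d) := fun t ht => by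
    have := hm t ht
    nlinarith [sq_nonneg d]
  have key := taylor_lower_of_deriv2 (m := m * d ^ 2) hf hg hg0 hh
  simp only [zero_mul, add_zero, sub_zero, one_mul] at key
  unfold bondBregman
  have e : l + d = l' := by rw [hd]; ring
  rw [e] at key
  nlinarith [key]

/-- ★ **`ljThirdDeriv r = −182 r⁻¹⁵ + 56 r⁻⁹`** — the third-derivative table of `V_LJ`: NEGATIVE below `(13/4)^{1/6} ≈ 1.2171` (where `V''` decreases), so on
the whole nearest-neighbour soft window the stiffness of a bond DROPS under stretch at the relative rate `|V⁽³⁾|/V'' ≈ 21/ℓ` — the anharmonicity length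
`V''/|V⁽³⁾| ≈ 0.048` against which «WINDOW-LOSSY-95» measures the chord excursion `sb₁ + τ⋆ ≈ 0.037`. [this file, g95] -/
def ljThirdDeriv (r : ℝ) : ℝ := -182 * (r⁻¹) ^ 15 + 56 * (r⁻¹) ^ 9

/-- `ljSecondDeriv` is differentiable away from `0` with derivative `ljThirdDeriv`. [this file, g95] -/
theorem hasDerivAt_ljSecondDeriv {r : ℝ} (hr : r ≠ 0) : HasDerivAt ljSecondDeriv (ljThirdDeriv r) r := by
  have hinv : HasDerivAt (fun y : ℝ => y⁻¹) (-(r ^ 2)⁻¹) r := hasDerivAt_inv hr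
  have h14 := ((hasDerivAt_pow 14 r⁻¹).comp r hinv).const_mul (13 : ℝ)
  have h8 := ((hasDerivAt_pow 8 r⁻¹).comp r hinv).const_mul (7 : ℝ)
  have h := h14.sub h8
  refine (h.congr_of_eventuallyEq (Eventually.of_forall fun y => ?_)).congr_deriv ?_
  · simp [ljSecondDeriv, Function.comp]
  · simp only [ljThirdDeriv, ← inv_pow]
    ring

/-- `V_LJ⁽³⁾ ≤ 0` for `0 < r`, `r⁶ ≤ 13/4`. [this file, g95] -/
theorem ljThirdDeriv_nonpos {r : ℝ} (hr : 0 < r) (h : r ^ 6 ≤ 13 / 4) : ljThirdDeriv r ≤ 0 := by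
  have hi : 0 < r⁻¹ := inv_pos.2 hr
  have h9 : 0 < (r⁻¹) ^ 9 := pow_pos hi 9
  have h6 : 4 / 13 ≤ (r⁻¹) ^ 6 := by
    rw [inv_pow, le_inv_comm₀ (by norm_num) (pow_pos hr 6)]
    have e : (4 / 13 : ℝ)⁻¹ = 13 / 4 := by norm_num
    rw [e]; exact h
  have e15 : (r⁻¹) ^ 15 = (r⁻¹) ^ 9 * (r⁻¹) ^ 6 := by ring
  unfold ljThirdDeriv
  rw [e15]
  nlinarith [mul_nonneg h9.le (show (0 : ℝ) ≤ 182 * (r⁻¹) ^ 6 - 56 by linarith)]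

/-- ★ **`V_LJ''` IS ANTITONE BELOW `(13/4)^{1/6}` (PROVED)**: `0 < x ≤ y`, `y⁶ ≤ 13/4` give `V''(y) ≤ V''(x)` — on the soft nearest-neighbour window a longer bond
is a softer bond (mean-value form of `V⁽³⁾ ≤ 0`). [this file, g95] -/
theorem ljSecondDeriv_le_of_le {x y : ℝ} (hx : 0 < x) (hxy : x ≤ y) (hy : y ^ 6 ≤ 13 / 4) : ljSecondDeriv y ≤ ljSecondDeriv x := by
  have hD : Convex ℝ (Icc x y) := convex_Icc x y
  have hne : ∀ t ∈ Icc x y, t ≠ 0 := fun t ht => (hx.trans_le ht.1).ne'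
  have hcont : ContinuousOn ljSecondDeriv (Icc x y) := fun t ht => (hasDerivAt_ljSecondDeriv (hne t ht)).continuousAt.continuousWithinAt
  have hdiff : DifferentiableOn ℝ ljSecondDeriv (interior (Icc x y)) := fun t ht => by
    rw [interior_Icc] at ht
    exact (hasDerivAt_ljSecondDeriv (hne t (Ioo_subset_Icc_self ht))).differentiableAt.differentiableWithinAt
  have hle : ∀ t ∈ interior (Icc x y), deriv ljSecondDeriv t ≤ 0 := fun t ht => by
    rw [interior_Icc] at ht
    have ht' := Ioo_subset_Icc_self ht
    rw [(hasDerivAt_ljSecondDeriv (hne t ht')).deriv]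
    have h6 : t ^ 6 ≤ 13 / 4 := (pow_le_pow_left₀ (hx.trans_le ht'.1).le ht'.2 6).trans hy
    exact ljThirdDeriv_nonpos (hx.trans_le ht'.1) h6
  exact antitoneOn_of_deriv_nonpos hD hcont hdiff hle (left_mem_Icc.2 hxy) (right_mem_Icc.2 hxy) hxy

/-- ★ **THE GLOBAL FLOOR OF `V_LJ''` (PROVED)**: `−2/3 ≤ V''(r)` for every `r > 0` (the minimum is `−3·(4/13)^{4/3} ≈ −0.6231` at `r⁶ = 13/4`; a sum of squares in
`p = r⁻²`). [this file, g95] -/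
theorem neg_two_thirds_le_ljSecondDeriv {r : ℝ} (hr : 0 < r) : -(2 / 3) ≤ ljSecondDeriv r := by
  have hi : 0 ≤ r⁻¹ := (inv_pos.2 hr).le
  set p : ℝ := (r⁻¹) ^ 2 with hp
  have hp0 : 0 ≤ p := pow_nonneg hi 2
  have e14 : (r⁻¹) ^ 14 = p ^ 7 := by rw [hp]; ring
  have e8 : (r⁻¹) ^ 8 = p ^ 4 := by rw [hp]; ring
  unfold ljSecondDeriv
  rw [e14, e8]
  nlinarith [mul_nonneg hp0 (sq_nonneg (p ^ 3 - 4 / 13)), sq_nonneg (p ^ 2 - 9 / 20), sq_nonneg (p - 80 / 117)]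

/-- ★★ **THE LONGER-END HULL BOUND (PROVED) — the certificate's windowed stretch modulus**: for bond lengths `0 < l, l' ≤ L` with `L⁶ ≤ 13/4`
(e.g. `L = 1.10005`, the soft nearest-neighbour ceiling of WINDOW-PIN), `V''(max l l')/2 · (l' − l)² ≤ bondBregman V V' l l'` — the stretch remainder of a bond
is at least the harmonic one with the stiffness of its LONGER end. [this file, g95] -/
theorem bondBregman_ge_longerEnd {l l' L : ℝ} (hl : 0 < l) (hl' : 0 < l') (hlL : l ≤ L) (hl'L : l' ≤ L) (hL : L ^ 6 ≤ 13 / 4) :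
    ljSecondDeriv (max l l') / 2 * (l' - l) ^ 2 ≤ bondBregman lennardJones ljDeriv l l' := by
  refine bondBregman_ge_of_le_deriv2 hl hl' fun t ht => ?_
  have hlo : min l l' ≤ l + t * (l' - l) := by
    rcases le_total l l' with h | h
    · rw [min_eq_left h]; nlinarith [ht.1]
    · rw [min_eq_right h]; nlinarith [ht.2]
  have hhi : l + t * (l' - l) ≤ max l l' := by
    rcases le_total l l' with h | h
    · rw [max_eq_right h]; nlinarith [ht.2]
    · rw [max_eq_left h]; nlinarith [ht.1]
  have hpos : 0 < l + t * (l' - l) := (lt_min hl hl').trans_le hlo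
  have h6 : (max l l') ^ 6 ≤ 13 / 4 := (pow_le_pow_left₀ (hl.le.trans (le_max_left l l')) (max_le hlL hl'L) 6).trans hL
  exact ljSecondDeriv_le_of_le hpos hhi h6

/-- the record specialisation: below the soft nearest-neighbour ceiling `1.10005` of WINDOW-PIN the longer-end modulus applies (`1.10005⁶ ≤ 13/4`). [this file, g95] -/
theorem bondBregman_ge_longerEnd_record {l l' : ℝ} (hl : 0 < l) (hl' : 0 < l') (hlL : l ≤ 1.10005) (hl'L : l' ≤ 1.10005) :
    ljSecondDeriv (max l l') / 2 * (l' - l) ^ 2 ≤ bondBregman lennardJones ljDeriv l l' :=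
  bondBregman_ge_longerEnd hl hl' hlL hl'L (by norm_num)

end Ledger

/-! ### ZZZYL-2  THE CUT OF (BCᴸ): (LDᴸ) `FirstVariationP` ∧ (QLᴸ) `SoftLedgerFloorP … c` ⟹ (BCᴸ)(c) (glue PROVED); door W2k -/

section Pieces

/-- ★★ **(LDᴸ) «FirstVariationP …» — THE FIRST VARIATION OF THE CLAMPED ENERGY AT THE FILLING.**  Under the binders of (BCᴸ) up to the tube-minimality of
the critical inner-tube filling `y` (injective, disjoint from the frozen exterior `X = S ∖ core`): the clamped energy `E = clampedEnergy X` has a Fréchet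
derivative `Λ` at `y`, the exterior pair derivatives `q ↦ pairDeriv (y i) q u` are summable over `X`, and
`Λ w = Σ_i Σ_{j > i} pairDeriv (y i) (y j) (w i − w j) + Σ_i Σ'_{q ∈ X} pairDeriv (y i) q (w i)`.  ANALYTIC · ROUTINE · TRUE-type (finite interior sum of
tree N-force-balance's `hasFDerivAt_pair`; exterior: dominated differentiation of the `r⁻⁷`-tailed pair-derivative series on the separated set `X`, as in
tree N-force-balance §4 — the point `y i` is NOT an atom of `S`, so the tree's atom-based lemma is ported in §ZZZYL-3) · the first-order half of (C2ᴸ) ·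
PROVED BELOW at all dials (`firstVariationP_holds`); kept as a named statement because the two-piece glue and door W2k are stated over it.
With criticality (`HasFDerivAt E 0 y`, a binder) `Λ = 0`, so the pair-derivative sum VANISHES on every `w`: the linear terms of the ledger cancel.
Sources: tree N-force-balance (`pairDeriv`, `hasFDerivAt_pair`, `hasFDerivAt_siteEnergy`), UH (`clampedEnergy`), TF (`summable_inv_pow_six_far`). [this file, g95] -/
def FirstVariationP (ϑc ϑ ϑp r rΘ q rsh ρ rm σ ϑr Rs ε rI ℓ Rg sb₁ dI₁ dB₁ aHi Λ θ s : ℝ) : Prop :=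
  ∀ δ : ℝ, 0 < δ → ∀ a : ℝ, 0 < a →
    ∀ S : Set E3, IsDoorSetP aHi δ S → (∀ z : E3, Summable fun y : S => lennardJones (dist z (y : E3))) →
      (∀ p ∈ S, IsTwoShellAffineGood θ S p) →
        ∀ (L : E3 ≃L[ℝ] E3) (w : ℤ → E3), IsEquilChart a s Λ L w →
          ∀ (x₀ : E3) (K : Set E3), K ⊆ S → (∀ k ∈ K, dist k x₀ ≤ q) →
            IsTameOn ϑp S (LayeredHom (L : E3 →L[ℝ] E3) w) (coreOf S K rm) →
              IsTameOn ϑc S (LayeredHom (L : E3 →L[ℝ] E3) w) (moatIn S K r (r + rsh)) →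
                ∀ (n : ℕ) (xf : Fin n → E3), Function.Injective xf → Set.range xf = coreOf S K ρ →
                  ∀ (L' : E3 →L[ℝ] E3) (w' : ℤ → E3) (U : E3 ≃ₗᵢ[ℝ] E3) (t : E3),
                    IsCoolShadowCrystal σ ϑr Rs ε r rI ℓ S K (LayeredHom (L : E3 →L[ℝ] E3) w) L' w' U t →
                      ∀ lab : E3 → E3, IsBondLabel ε rΘ ℓ S K (placedCrystal L' w' U t) lab →
                        ∀ y ∈ bondTube (S \ coreOf S K ρ) Rg sb₁ dI₁ dB₁ (fun i => lab (xf i)),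
                          Function.Injective y → Disjoint (Set.range y) (S \ coreOf S K ρ) →
                            HasFDerivAt (fun z : Fin n → E3 => clampedEnergy (S \ coreOf S K ρ) z) (0 : (Fin n → E3) →L[ℝ] ℝ) y →
                              (∀ i, IsTameStar ϑ ((S \ coreOf S K ρ) ∪ Set.range y) (LayeredHom (L : E3 →L[ℝ] E3) w) (y i)) →
                              (∀ z ∈ bondTube (S \ coreOf S K ρ) Rg sb₁ dI₁ dB₁ (fun i => lab (xf i)),
                                  clampedEnergy (S \ coreOf S K ρ) y ≤ clampedEnergy (S \ coreOf S K ρ) z) →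
                                ∃ Λ' : (Fin n → E3) →L[ℝ] ℝ,
                                  HasFDerivAt (fun z : Fin n → E3 => clampedEnergy (S \ coreOf S K ρ) z) Λ' y ∧
                                    (∀ (i : Fin n) (u : E3), Summable fun q' : ↥(S \ coreOf S K ρ) => pairDeriv (y i) (q' : E3) u) ∧
                                      ∀ w₁ : Fin n → E3, Λ' w₁ =
                                        (∑ i, ∑ j ∈ Finset.Ioi i, pairDeriv (y i) (y j) (w₁ i - w₁ j)) +
                                          ∑ i, ∑' q' : ↥(S \ coreOf S K ρ), pairDeriv (y i) (q' : E3) (w₁ i)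

/-- ★★★ **(QLᴸ) «SoftLedgerFloorP … Rg sb₁ dI₁ dB₁ sb⁺ dI⁺ dB⁺ Rd τ c …» — THE BONDWISE LEDGER FLOOR ALONG SOFT FAT-TUBE COMPETITORS (the content).**
Under the binders of (BCᴸ): for every `z` of the FAT tube that is `τ`-SOFT about the critical filling `y` at pair range `Rd`, the exterior lower ledgers
`q ↦ pairLedgerLower (y i − q) (z i − y i)` are summable over `X = S ∖ core` and
`c · pairDevSq Rg (lab ∘ xf) y z ≤ Σ_i Σ_{j > i} pairLedgerLower (y i − y j) ((z i − z j) − (y i − y j)) + Σ_i Σ'_{q ∈ X} pairLedgerLower (y i − q) (z i − y i)`.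
ENERGETIC-ALGEBRAIC (an explicit function of the bond lengths of `y`, `z` and the pair deviations; no energy functional, no derivative) · LOCAL · NEW ·
UNDECIDED · strictly WEAKER a demand than the exact ledger (tension credits dropped, compression excess maximal — TIGHT for rotated sub-regions, where the
clamped rim's stretch remainders must pay: the GLOBAL mechanism of (HSᴸ)/(BCᴸ) in ledger form) · antitone in `c` (`.of_le`) · with (LDᴸ) it gives (BCᴸ)(c)
(`softBregmanCoerciveP_of_ledger`, PROVED).  CERTIFICATE STATUS (desk «WINDOW-BLOCH-95», memo §1–§2): on the clean-admissible placed label crystals the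
`y`-exact bulk Bloch floor of this ledger is POSITIVE on the isotropic window `[0.86, 1.02]` at `τ⋆ = 249/10000` and NEGATIVE (i) at the registered
inner-tube radius `sb₁ = 249/20000` (the pre-stress charge at `‖b‖ ∈ [ℓ̂ − sb₁, ℓ̂ + sb₁]`), (ii) at every anisotropic Clean-edge label strain (uniaxial
`±1/16`, where the label crystal's own floor is `≤ 4·10⁻⁴`) — so a proof needs a LABEL-STRAIN PIN (grand-canonical minimality of the core, available in the
clamped door chain) and the (X2ᴸ′) radius `sb₁` an order below its registered ceiling; both are dials/inputs of OTHER leaves, reported not patched.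
Why it might fail: as (BCᴸ) — only by mis-dialling (`c` too large for the softest admissible label crystal; fat radii allowing collisions, where the junk
value `V(0) = 0` enters both sides).  Sources: tree ZZZYI (`pair_ledger`, `bondBregman`, (BCᴸ)), ZZZYJ (WINDOW-PIN), this file §ZZZYL-1; Wallace,
Thermodynamics of Crystals (1972) ch. 7 (stability under load); E & Ming, ARMA 183 (2007) (Cauchy–Born stability); memo NODE-g95.md. [this file, g95] -/
def SoftLedgerFloorP (ϑc ϑ ϑp r rΘ q rsh ρ rm σ ϑr Rs ε rI ℓ Rg sb₁ dI₁ dB₁ sbp dIp dBp Rd τ c aHi Λ θ s : ℝ) : Prop :=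
  ∀ δ : ℝ, 0 < δ → ∀ a : ℝ, 0 < a →
    ∀ S : Set E3, IsDoorSetP aHi δ S → (∀ z : E3, Summable fun y : S => lennardJones (dist z (y : E3))) →
      (∀ p ∈ S, IsTwoShellAffineGood θ S p) →
        ∀ (L : E3 ≃L[ℝ] E3) (w : ℤ → E3), IsEquilChart a s Λ L w →
          ∀ (x₀ : E3) (K : Set E3), K ⊆ S → (∀ k ∈ K, dist k x₀ ≤ q) →
            IsTameOn ϑp S (LayeredHom (L : E3 →L[ℝ] E3) w) (coreOf S K rm) →
              IsTameOn ϑc S (LayeredHom (L : E3 →L[ℝ] E3) w) (moatIn S K r (r + rsh)) →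
                ∀ (n : ℕ) (xf : Fin n → E3), Function.Injective xf → Set.range xf = coreOf S K ρ →
                  ∀ (L' : E3 →L[ℝ] E3) (w' : ℤ → E3) (U : E3 ≃ₗᵢ[ℝ] E3) (t : E3),
                    IsCoolShadowCrystal σ ϑr Rs ε r rI ℓ S K (LayeredHom (L : E3 →L[ℝ] E3) w) L' w' U t →
                      ∀ lab : E3 → E3, IsBondLabel ε rΘ ℓ S K (placedCrystal L' w' U t) lab →
                        ∀ y ∈ bondTube (S \ coreOf S K ρ) Rg sb₁ dI₁ dB₁ (fun i => lab (xf i)),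
                          Function.Injective y → Disjoint (Set.range y) (S \ coreOf S K ρ) →
                            HasFDerivAt (fun z : Fin n → E3 => clampedEnergy (S \ coreOf S K ρ) z) (0 : (Fin n → E3) →L[ℝ] ℝ) y →
                              (∀ i, IsTameStar ϑ ((S \ coreOf S K ρ) ∪ Set.range y) (LayeredHom (L : E3 →L[ℝ] E3) w) (y i)) →
                              (∀ z ∈ bondTube (S \ coreOf S K ρ) Rg sb₁ dI₁ dB₁ (fun i => lab (xf i)),
                                  clampedEnergy (S \ coreOf S K ρ) y ≤ clampedEnergy (S \ coreOf S K ρ) z) →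
                                ∀ z ∈ bondTube (S \ coreOf S K ρ) Rg sbp dIp dBp (fun i => lab (xf i)),
                                  IsSoftAbout Rd τ (fun i => lab (xf i)) y z →
                                    (∀ i : Fin n, Summable fun q' : ↥(S \ coreOf S K ρ) => pairLedgerLower (y i - (q' : E3)) (z i - y i)) ∧
                                      c * pairDevSq Rg (fun i => lab (xf i)) y z ≤
                                        (∑ i, ∑ j ∈ Finset.Ioi i, pairLedgerLower (y i - y j) ((z i - z j) - (y i - y j))) +
                                          ∑ i, ∑' q' : ↥(S \ coreOf S K ρ), pairLedgerLower (y i - (q' : E3)) (z i - y i)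

variable {ϑc ϑ ϑp r rΘ q rsh ρ rm σ ϑr Rs ε rI ℓ Rg sb₁ dI₁ dB₁ sbp dIp dBp Rd τ c c' g₀ aHi Λ θ s : ℝ}

/-- (QLᴸ) is antitone in the modulus `c`. [formal bookkeeping] -/
theorem SoftLedgerFloorP.of_le (hc : c' ≤ c)
    (h : SoftLedgerFloorP ϑc ϑ ϑp r rΘ q rsh ρ rm σ ϑr Rs ε rI ℓ Rg sb₁ dI₁ dB₁ sbp dIp dBp Rd τ c aHi Λ θ s) :
    SoftLedgerFloorP ϑc ϑ ϑp r rΘ q rsh ρ rm σ ϑr Rs ε rI ℓ Rg sb₁ dI₁ dB₁ sbp dIp dBp Rd τ c' aHi Λ θ s := by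
  intro δ hδ a ha S hS hsum hgood L w hLw x₀ K hKS hKq hmild hcool n xf hxf hrange L' w' U t hC lab hlab y hy hyinj hydisj hcrit htame hmin z hz hsoft
  obtain ⟨h1, h2⟩ := h δ hδ a ha S hS hsum hgood L w hLw x₀ K hKS hKq hmild hcool n xf hxf hrange L' w' U t hC lab hlab y hy hyinj hydisj hcrit htame hmin
    z hz hsoft
  exact ⟨h1, (mul_le_mul_of_nonneg_right hc (pairDevSq_nonneg Rg (fun i => lab (xf i)) y z)).trans h2⟩

end Pieces

end Summit.AtomisticToContinuum.Crystallization.Theorems.ChartedZeroExcessLayeredLatticeLiouville
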